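import Mathlib.Analysis.Calculus.MeanValue
import Mathlib.Analysis.Calculus.Deriv.Shift
import Mathlib.Topology.MetricSpace.Thickening
import Literature.Dynamics.Hyperbolic.HyperbolicSemiflowModel

/-!
# Orbits of a `C²` local semiflow model near its compact invariant set

Topic `Literature/Dynamics/Hyperbolic`.  Fully proved consequences (no definitions, no named facts) of the standing hypotheses
`Literature.Dynamics.Hyperbolic.IsHyperbolicSemiflowModel U Λ g m` (a local semiflow `g` on an open set `U` of a real Banach
space, jointly `C²` on `(0,2) × U` and continuous on `[0,2] × U`, a compact invariant set `Λ ⊆ U` on which every `g_t` is a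
bijection) that the closing lemma along Pesin sets (`HasAmbientClosing`; registered stub `stub_ambientClosing` of the
Navier–Stokes line `ergodic-budget-selection-closing`, `Summits/AnomalousDissipation`) consumes when it DECODES a closed orbit
(`ClosedOrbitDecoding.exists_closedOrbit_of_transitSchedule`) and when it sets up transversal sections (`SemiflowPoincareMap`):

* §1 `exists_forall_dist_lt_of_continuousOn` — a map continuous on `D` is uniformly continuous AT a compact `K ⊆ D`
  (one point in `K`, the other anywhere in `D`; Lebesgue-number argument);
* §2 `exists_forall_mem_of_dist_lt`, `exists_forall_dist_apply_lt` — a uniform neighbourhood of `Λ` inside `U`, and UNIFORM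
  CONTINUITY of the model near `[0, S] × Λ`, `S ≤ 2`: points `r`-close to `x ∈ Λ` stay in `U` up to time `S` and `ε`-close to the
  orbit of `x` (the hypotheses `hyS`, `hloc` of `exists_closedOrbit_of_transitSchedule`);
* §3 `exists_norm_fderiv_le`, `hasDerivAt_orbit`, `dist_orbit_le_of_mem_Icc`, `exists_forall_dist_orbit_le` — the joint derivative
  is bounded on `[a, b] × Λ ⊂ (0,2) × U`, orbits are differentiable at interior times, and the orbits of points of `Λ` are UNIFORMLY
  LIPSCHITZ IN TIME on `[0, ∞)` (via `Λ = g₁ Λ` and the semigroup law; the hypothesis `hx_lip` of the decoding);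
* §4 the FLOW DIRECTION on `Λ`: `hasDerivWithinAt_flowDir` (the orbit of `x ∈ Λ` is right-differentiable at `0` with derivative
  `flowDir g x`), `flowDir_eq` (`= ∂ₜ g (1, x')` for `x = g₁ x'`), `exists_norm_flowDir_le` (bounded on `Λ`), `continuousOn_flowDir`
  (continuous on `Λ`, through the homeomorphism `g₁|_Λ`), `fderiv_apply_flowDir`
  (EQUIVARIANCE `D(g₁)(x) X(x) = X(g₁ x)`), `derivCocycle_apply_flowDir` (`Tⁿₓ X(x) = X(gₙ x)`), `seqSubExpGrowth_flowDir` (the flow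
  direction grows sub-exponentially under the cocycle, so the hyperbolicity axiom applies to it).

## References

* Z. Lian, L.-S. Young, *Lyapunov exponents, periodic orbits, and horseshoes for semiflows on Hilbert spaces*, J. Amer. Math. Soc. 25
  (2012) 637–665, §1 (standing hypotheses). [LianYoung2012]
* L. Barreira, Ya. Pesin, *Introduction to Smooth Ergodic Theory*, 2nd ed., GSM 231, AMS (2023), Ch. 4, §11.2. [BarreiraPesin2023]
-/

noncomputable section

open Set Function Metric Filter
open scoped Topology

namespace Literature.Dynamics.Hyperbolic

/-! ## §1 Uniform continuity at a compact subset of the domain of continuity -/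

/-- **Uniform continuity at a compact set.**  If `f` is continuous on `D` and `K ⊆ D` is compact, then for every `ε > 0` there is
`δ > 0` such that `dist (f y) (f x) < ε` whenever `x ∈ K`, `y ∈ D` and `dist y x < δ` (the second point ranges over all of `D`).
[folklore] -/
theorem exists_forall_dist_lt_of_continuousOn {α β : Type*} [PseudoMetricSpace α] [PseudoMetricSpace β] {f : α → β}
    {D K : Set α} (hf : ContinuousOn f D) (hK : IsCompact K) (hKD : K ⊆ D) {ε : ℝ} (hε : 0 < ε) :
    ∃ δ > 0, ∀ x ∈ K, ∀ y ∈ D, dist y x < δ → dist (f y) (f x) < ε := by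
  -- a radius of `ε/2`-oscillation inside `D` at each point of `K`
  have hρ : ∀ x ∈ K, ∃ ρ > 0, ∀ y ∈ D, dist y x < ρ → dist (f y) (f x) < ε / 2 := by
    intro x hx
    obtain ⟨ρ, hρ, h⟩ := Metric.continuousWithinAt_iff.1 (hf x (hKD hx)) (ε / 2) (half_pos hε)
    exact ⟨ρ, hρ, fun y hy hyx => h hy hyx⟩
  choose! ρ hρ hosc using hρ
  obtain ⟨δ, hδ, hball⟩ := lebesgue_number_lemma_of_metric hK (c := fun x : K => ball (x : α) (ρ x / 2))
    (fun _ => isOpen_ball) (fun x hx => mem_iUnion.2 ⟨⟨x, hx⟩, mem_ball_self (half_pos (hρ x hx))⟩)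
  refine ⟨δ, hδ, fun x hx y hy hyx => ?_⟩
  obtain ⟨⟨z, hz⟩, hsub⟩ := hball x hx
  have hxz : dist x z < ρ z / 2 := hsub (mem_ball_self hδ)
  have hyz : dist y z < ρ z / 2 := hsub (mem_ball.2 hyx)
  have h1 := hosc z hz y hy (by linarith [hρ z hz])
  have h2 := hosc z hz x (hKD hx) (by linarith [hρ z hz])
  calc dist (f y) (f x) ≤ dist (f y) (f z) + dist (f x) (f z) := dist_triangle_right _ _ _
    _ < ε / 2 + ε / 2 := add_lt_add h1 h2
    _ = ε := add_halves ε

namespace IsHyperbolicSemiflowModel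

variable {E : Type*} [NormedAddCommGroup E] [NormedSpace ℝ E] [MeasurableSpace E]
  {U Λ : Set E} {g : ℝ → E → E} {m : MeasureTheory.Measure E}

/-! ## §2 Uniform neighbourhoods of `Λ` -/

/-- A uniform neighbourhood of the compact `Λ` inside the open `U`: points `r`-close to `Λ` lie in `U`. [folklore] -/
theorem exists_forall_mem_of_dist_lt (h : IsHyperbolicSemiflowModel U Λ g m) :
    ∃ r > 0, ∀ x ∈ Λ, ∀ y : E, dist y x < r → y ∈ U := by
  obtain ⟨r, hr, hsub⟩ := h.isCompact.exists_thickening_subset_open h.isOpen h.subset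
  exact ⟨r, hr, fun x hx y hyx => hsub (mem_thickening_iff.2 ⟨x, hx, hyx⟩)⟩

/-- **Uniform continuity of the model near `[0, S] × Λ` (`S ≤ 2`).**  For every `ε > 0` there is `r > 0` such that every `y`
within `r` of a point `x ∈ Λ` lies in `U`, and its orbit stays in `U` and `ε`-close to the orbit of `x` up to time `S`:
`g s y ∈ U`, `dist (g s y) (g s x) < ε` for `s ∈ [0, S]`. [folklore] -/
theorem exists_forall_dist_apply_lt (h : IsHyperbolicSemiflowModel U Λ g m) {S : ℝ} (hS : S ≤ 2) {ε : ℝ} (hε : 0 < ε) :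
    ∃ r > 0, ∀ x ∈ Λ, ∀ y : E, dist y x < r → y ∈ U ∧ ∀ s ∈ Icc 0 S, g s y ∈ U ∧ dist (g s y) (g s x) < ε := by
  obtain ⟨r₀, hr₀, hU⟩ := h.exists_forall_mem_of_dist_lt
  have hK : IsCompact (Icc (0 : ℝ) S ×ˢ Λ) := isCompact_Icc.prod h.isCompact
  have hKD : Icc (0 : ℝ) S ×ˢ Λ ⊆ Icc (0 : ℝ) 2 ×ˢ U := prod_mono (Icc_subset_Icc_right hS) h.subset
  obtain ⟨δ, hδ, hcont⟩ := exists_forall_dist_lt_of_continuousOn h.continuousOn hK hKD (lt_min hε hr₀)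
  refine ⟨min r₀ δ, lt_min hr₀ hδ, fun x hx y hyx => ?_⟩
  have hyU : y ∈ U := hU x hx y (hyx.trans_le (min_le_left _ _))
  refine ⟨hyU, fun s hs => ?_⟩
  have hq : dist ((s, y) : ℝ × E) (s, x) < δ := by
    rw [Prod.dist_eq, dist_self, max_eq_right dist_nonneg]
    exact hyx.trans_le (min_le_right _ _)
  have h1 : dist (g s y) (g s x) < min ε r₀ := hcont (s, x) ⟨hs, hx⟩ (s, y) ⟨⟨hs.1, hs.2.trans hS⟩, hyU⟩ hq
  exact ⟨hU (g s x) (h.mapsTo s hs.1 hx) _ (h1.trans_le (min_le_right _ _)), h1.trans_le (min_le_left _ _)⟩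

/-! ## §3 Derivative bounds and time-Lipschitz orbits -/

/-- The joint derivative `D g` is bounded on `[a, b] × Λ` for `0 < a`, `b < 2` (continuity of `D g` on the open `(0,2) × U`,
compactness of `[a, b] × Λ`). [folklore] -/
theorem exists_norm_fderiv_le (h : IsHyperbolicSemiflowModel U Λ g m) {a b : ℝ} (ha : 0 < a) (hb : b < 2) :
    ∃ M, ∀ q ∈ Icc a b ×ˢ Λ, ‖fderiv ℝ (fun q : ℝ × E => g q.1 q.2) q‖ ≤ M := by
  have hW : IsOpen (Ioo (0 : ℝ) 2 ×ˢ U) := isOpen_Ioo.prod h.isOpen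
  have hc : ContinuousOn (fderiv ℝ (fun q : ℝ × E => g q.1 q.2)) (Ioo (0 : ℝ) 2 ×ˢ U) :=
    h.contDiffOn.continuousOn_fderiv_of_isOpen hW (by norm_num)
  have hK : IsCompact (Icc a b ×ˢ Λ) := isCompact_Icc.prod h.isCompact
  have hKW : Icc a b ×ˢ Λ ⊆ Ioo (0 : ℝ) 2 ×ˢ U := prod_mono (Icc_subset_Ioo ha hb) h.subset
  exact hK.exists_bound_of_continuousOn (hc.mono hKW)

/-- The joint derivative of the model at a point of `(0,2) × U`. [folklore] -/
theorem hasFDerivAt_uncurry (h : IsHyperbolicSemiflowModel U Λ g m) {x : E} (hx : x ∈ U) {t : ℝ} (ht : t ∈ Ioo (0 : ℝ) 2) :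
    HasFDerivAt (fun q : ℝ × E => g q.1 q.2) (fderiv ℝ (fun q : ℝ × E => g q.1 q.2) (t, x)) (t, x) := by
  have hW : IsOpen (Ioo (0 : ℝ) 2 ×ˢ U) := isOpen_Ioo.prod h.isOpen
  exact (h.contDiffOn.differentiableOn (by norm_num)).hasFDerivAt (hW.mem_nhds ⟨ht, hx⟩)

/-- **Orbits are differentiable at interior times**: for `x ∈ U` and `t ∈ (0,2)` the orbit `s ↦ g s x` has derivative
`D g (t, x) (1, 0)` at `t`. [folklore] -/
theorem hasDerivAt_orbit (h : IsHyperbolicSemiflowModel U Λ g m) {x : E} (hx : x ∈ U) {t : ℝ} (ht : t ∈ Ioo (0 : ℝ) 2) :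
    HasDerivAt (fun s => g s x) (fderiv ℝ (fun q : ℝ × E => g q.1 q.2) (t, x) (1, 0)) t := by
  have h1 := ((h.hasFDerivAt_uncurry hx ht).comp t (hasFDerivAt_prodMk_left t x)).hasDerivAt
  simpa [Function.comp_def] using h1

/-- The time-`t` map is differentiable at `x ∈ U`, `t ∈ (0,2)`, with derivative `D g (t, x) ∘ inr`. [folklore] -/
theorem hasFDerivAt_map (h : IsHyperbolicSemiflowModel U Λ g m) {x : E} (hx : x ∈ U) {t : ℝ} (ht : t ∈ Ioo (0 : ℝ) 2) :
    HasFDerivAt (g t) ((fderiv ℝ (fun q : ℝ × E => g q.1 q.2) (t, x)).comp (ContinuousLinearMap.inr ℝ ℝ E)) x := by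
  have h1 := (h.hasFDerivAt_uncurry hx ht).comp x (hasFDerivAt_prodMk_right t x)
  simpa [Function.comp_def] using h1

/-- **Mean value bound on a compact time window**: if `‖D g‖ ≤ M` on `[a, b] × Λ` (`0 < a`, `b < 2`), then for `x ∈ Λ` and
`s, t ∈ [a, b]`, `dist (g s x) (g t x) ≤ M |s − t|`. [folklore] -/
theorem dist_orbit_le_of_mem_Icc (h : IsHyperbolicSemiflowModel U Λ g m) {a b M : ℝ} (ha : 0 < a) (hb : b < 2)
    (hM : ∀ q ∈ Icc a b ×ˢ Λ, ‖fderiv ℝ (fun q : ℝ × E => g q.1 q.2) q‖ ≤ M)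
    {x : E} (hx : x ∈ Λ) {s t : ℝ} (hs : s ∈ Icc a b) (ht : t ∈ Icc a b) :
    dist (g s x) (g t x) ≤ M * |s - t| := by
  wlog hst : s ≤ t generalizing s t
  · rw [dist_comm, abs_sub_comm]; exact this ht hs (le_of_not_ge hst)
  have hderiv : ∀ u ∈ Icc s t, HasDerivWithinAt (fun r => g r x)
      (fderiv ℝ (fun q : ℝ × E => g q.1 q.2) (u, x) (1, 0)) (Icc s t) u := fun u hu =>
    (h.hasDerivAt_orbit (h.subset hx) ⟨ha.trans_le (hs.1.trans hu.1), (hu.2.trans ht.2).trans_lt hb⟩).hasDerivWithinAt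
  have hbound : ∀ u ∈ Ico s t, ‖fderiv ℝ (fun q : ℝ × E => g q.1 q.2) (u, x) (1, 0)‖ ≤ M := by
    intro u hu
    refine ((fderiv ℝ (fun q : ℝ × E => g q.1 q.2) (u, x)).le_opNorm _).trans ?_
    have h1 : ‖((1 : ℝ), (0 : E))‖ = 1 := by simp [Prod.norm_def]
    rw [h1, mul_one]
    exact hM (u, x) ⟨⟨hs.1.trans hu.1, hu.2.le.trans ht.2⟩, hx⟩
  have h2 := norm_image_sub_le_of_norm_deriv_le_segment' hderiv hbound t (right_mem_Icc.2 hst)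
  rw [dist_comm, dist_eq_norm, abs_of_nonpos (sub_nonpos.2 hst), neg_sub]
  exact h2

/-- **Orbits in `Λ` are uniformly Lipschitz in time.**  There is `V ≥ 0` with `dist (g s x) (g t x) ≤ V |s − t|` for all
`x ∈ Λ` and `s, t ≥ 0`.  Proof: `‖D g‖ ≤ M` on `[1, 3/2] × Λ`; a step `[s, t]` of length `≤ 1/2` is read as `[1, 1 + (t − s)]`
applied to `x'' ∈ Λ` with `g₁ x'' = g_s x` (`Λ = g₁ Λ`, semigroup law); long intervals are chains of short steps. [folklore] -/
theorem exists_forall_dist_orbit_le (h : IsHyperbolicSemiflowModel U Λ g m) :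
    ∃ V, 0 ≤ V ∧ ∀ x ∈ Λ, ∀ s t : ℝ, 0 ≤ s → 0 ≤ t → dist (g s x) (g t x) ≤ V * |s - t| := by
  obtain ⟨M, hM⟩ := h.exists_norm_fderiv_le one_pos (by norm_num : (3 / 2 : ℝ) < 2)
  refine ⟨max M 0, le_max_right _ _, ?_⟩
  -- short steps
  have step : ∀ x ∈ Λ, ∀ s t : ℝ, 0 ≤ s → s ≤ t → t ≤ s + 1 / 2 → dist (g s x) (g t x) ≤ max M 0 * (t - s) := by
    intro x hx s t hs0 hst hts
    obtain ⟨x', hx', hx'eq⟩ := h.surjOn 1 zero_le_one (h.mapsTo s hs0 hx)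
    -- `g 1 x' = g s x`, `g (t - s + 1) x' = g t x`
    have e2 : g t x = g (t - s + 1) x' := by
      rw [h.map_add_of_mem (sub_nonneg.2 hst) zero_le_one hx', hx'eq, ← h.map_add_of_mem (sub_nonneg.2 hst) hs0 hx,
        sub_add_cancel]
    rw [← hx'eq, e2]
    have h1 := h.dist_orbit_le_of_mem_Icc one_pos (by norm_num : (3 / 2 : ℝ) < 2) hM hx'
      (s := 1) (t := t - s + 1) ⟨le_rfl, by norm_num⟩ ⟨by linarith, by linarith⟩
    calc dist (g 1 x') (g (t - s + 1) x') ≤ M * |1 - (t - s + 1)| := h1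
      _ = M * (t - s) := by rw [show (1 : ℝ) - (t - s + 1) = -(t - s) by ring, abs_neg, abs_of_nonneg (sub_nonneg.2 hst)]
      _ ≤ max M 0 * (t - s) := mul_le_mul_of_nonneg_right (le_max_left _ _) (sub_nonneg.2 hst)
  -- chains of short steps
  have chain : ∀ n : ℕ, ∀ x ∈ Λ, ∀ s t : ℝ, 0 ≤ s → s ≤ t → t - s ≤ n / 2 →
      dist (g s x) (g t x) ≤ max M 0 * (t - s) := by
    intro n
    induction n with
    | zero =>
      intro x hx s t hs0 hst h0
      have : t = s := by norm_num at h0; linarith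
      subst this
      simp
    | succ n ih =>
      intro x hx s t hs0 hst hn1
      by_cases hshort : t ≤ s + 1 / 2
      · exact step x hx s t hs0 hst hshort
      · have h1 := step x hx s (s + 1 / 2) hs0 (by linarith) le_rfl
        have h2 := ih x hx (s + 1 / 2) t (by linarith) (by linarith) (by push_cast at hn1 ⊢; linarith)
        calc dist (g s x) (g t x) ≤ dist (g s x) (g (s + 1 / 2) x) + dist (g (s + 1 / 2) x) (g t x) := dist_triangle _ _ _
          _ ≤ max M 0 * (s + 1 / 2 - s) + max M 0 * (t - (s + 1 / 2)) := add_le_add h1 h2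
          _ = max M 0 * (t - s) := by ring
  intro x hx s t hs ht
  wlog hst : s ≤ t generalizing s t
  · rw [dist_comm, abs_sub_comm]; exact this t s ht hs (le_of_not_ge hst)
  obtain ⟨n, hn⟩ := exists_nat_ge (2 * (t - s))
  rw [abs_of_nonpos (sub_nonpos.2 hst), neg_sub]
  exact chain n x hx s t hs hst (by linarith)

/-! ## §4 The flow direction on `Λ` -/

/-- For `x' ∈ Λ` and `x = g₁ x'`, the orbit of `x` is right-differentiable at `0` with derivative `∂ₜ g (1, x') = D g (1, x') (1, 0)`
(semigroup law `g_s x = g_{s+1} x'`). [folklore] -/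
theorem hasDerivWithinAt_orbit_zero (h : IsHyperbolicSemiflowModel U Λ g m) {x x' : E} (hx' : x' ∈ Λ) (hx : g 1 x' = x) :
    HasDerivWithinAt (fun s => g s x) (fderiv ℝ (fun q : ℝ × E => g q.1 q.2) (1, x') (1, 0)) (Ici 0) 0 := by
  have h1 : HasDerivAt (fun s => g s x') (fderiv ℝ (fun q : ℝ × E => g q.1 q.2) (1, x') (1, 0)) (0 + 1) := by
    rw [zero_add]; exact h.hasDerivAt_orbit (h.subset hx') ⟨one_pos, one_lt_two⟩
  have h2 := HasDerivAt.comp_add_const 0 1 h1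
  refine h2.hasDerivWithinAt.congr (fun s hs => ?_) ?_
  · rw [← hx]
    exact (h.map_add_of_mem (mem_Ici.1 hs) zero_le_one hx').symm
  · rw [← hx, zero_add]
    exact h.map_zero _ (h.subset (h.mapsTo 1 zero_le_one hx'))

/-- **The flow direction is the right derivative of the orbit** at every point of `Λ`:
`HasDerivWithinAt (g · x) (flowDir g x) [0, ∞) 0`. [folklore] -/
theorem hasDerivWithinAt_flowDir (h : IsHyperbolicSemiflowModel U Λ g m) {x : E} (hx : x ∈ Λ) :
    HasDerivWithinAt (fun s => g s x) (flowDir g x) (Ici 0) 0 := by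
  obtain ⟨x', hx', hxeq⟩ := h.surjOn 1 zero_le_one hx
  have hd := h.hasDerivWithinAt_orbit_zero hx' hxeq
  have he : flowDir g x = fderiv ℝ (fun q : ℝ × E => g q.1 q.2) (1, x') (1, 0) :=
    hd.derivWithin (uniqueDiffOn_Ici (0 : ℝ) 0 self_mem_Ici)
  rw [he]
  exact hd

/-- The flow direction at `x = g₁ x'`, `x' ∈ Λ`, is `∂ₜ g (1, x') = D g (1, x') (1, 0)`. [folklore] -/
theorem flowDir_eq (h : IsHyperbolicSemiflowModel U Λ g m) {x x' : E} (hx' : x' ∈ Λ) (hx : g 1 x' = x) :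
    flowDir g x = fderiv ℝ (fun q : ℝ × E => g q.1 q.2) (1, x') (1, 0) :=
  (h.hasDerivWithinAt_orbit_zero hx' hx).derivWithin (uniqueDiffOn_Ici (0 : ℝ) 0 self_mem_Ici)

/-- **The flow direction is bounded on `Λ`.** [folklore] -/
theorem exists_norm_flowDir_le (h : IsHyperbolicSemiflowModel U Λ g m) : ∃ M, ∀ x ∈ Λ, ‖flowDir g x‖ ≤ M := by
  obtain ⟨M, hM⟩ := h.exists_norm_fderiv_le one_pos (by norm_num : (3 / 2 : ℝ) < 2)
  refine ⟨M, fun x hx => ?_⟩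
  obtain ⟨x', hx', hxeq⟩ := h.surjOn 1 zero_le_one hx
  rw [h.flowDir_eq hx' hxeq]
  refine (ContinuousLinearMap.le_opNorm _ _).trans ?_
  have h1 : ‖((1 : ℝ), (0 : E))‖ = 1 := by simp [Prod.norm_def]
  rw [h1, mul_one]
  exact hM (1, x') ⟨⟨le_rfl, by norm_num⟩, hx'⟩

/-- **The flow direction is continuous on `Λ`.**  `X = F ∘ (g₁|_Λ)⁻¹` with `F x' = ∂ₜ g (1, x')` continuous and `g₁|_Λ` a
homeomorphism of the compact `Λ` (continuous bijection of a compact Hausdorff space). [folklore] -/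
theorem continuousOn_flowDir (h : IsHyperbolicSemiflowModel U Λ g m) : ContinuousOn (flowDir g) Λ := by
  have hW : IsOpen (Ioo (0 : ℝ) 2 ×ˢ U) := isOpen_Ioo.prod h.isOpen
  have hc : ContinuousOn (fderiv ℝ (fun q : ℝ × E => g q.1 q.2)) (Ioo (0 : ℝ) 2 ×ˢ U) :=
    h.contDiffOn.continuousOn_fderiv_of_isOpen hW (by norm_num)
  -- `F x' = D g (1, x') (1, 0)` is continuous on `Λ`
  set F : E → E := fun x' => fderiv ℝ (fun q : ℝ × E => g q.1 q.2) (1, x') (1, 0) with hFdef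
  have h1 : Continuous (fun x' : E => ((1 : ℝ), x')) := continuous_const.prodMk continuous_id
  have hF : ContinuousOn F Λ :=
    (hc.comp h1.continuousOn fun x' hx' => ⟨⟨one_pos, one_lt_two⟩, h.subset hx'⟩).clm_apply continuousOn_const
  -- `g 1` is continuous on `Λ`
  have hg1 : ContinuousOn (g 1) Λ :=
    h.continuousOn.comp h1.continuousOn fun x' hx' => ⟨⟨zero_le_one, one_le_two⟩, h.subset hx'⟩
  -- the restriction of `g 1` to `Λ` is a homeomorphism
  haveI : CompactSpace Λ := isCompact_iff_compactSpace.1 h.isCompact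
  let φ : Λ → Λ := fun p => ⟨g 1 p, h.mapsTo 1 zero_le_one p.2⟩
  have hφc : Continuous φ :=
    continuous_induced_rng.2 (hg1.comp_continuous continuous_subtype_val fun p => p.2)
  have hφb : Function.Bijective φ := by
    refine ⟨fun p q hpq => Subtype.ext (h.injOn 1 zero_le_one p.2 q.2 (congrArg Subtype.val hpq)), fun q => ?_⟩
    obtain ⟨p, hp, hpq⟩ := h.surjOn 1 zero_le_one q.2
    exact ⟨⟨p, hp⟩, Subtype.ext hpq⟩
  let Φ : Λ ≃ₜ Λ := Continuous.homeoOfEquivCompactToT2 (f := Equiv.ofBijective φ hφb) hφc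
  have hΦ : ∀ q : Λ, ((Φ q : Λ) : E) = g 1 (q : E) := fun q => rfl
  -- `flowDir g = F ∘ Φ⁻¹` on `Λ`
  rw [continuousOn_iff_continuous_restrict]
  have key : Λ.restrict (flowDir g) = fun p : Λ => F ((Φ.symm p : Λ) : E) := by
    funext p
    have hval : g 1 ((Φ.symm p : Λ) : E) = (p : E) := by rw [← hΦ, Φ.apply_symm_apply]
    exact h.flowDir_eq (Φ.symm p).2 hval
  rw [key]
  exact (hF.comp_continuous continuous_subtype_val fun q => q.2).comp Φ.symm.continuous

/-- **Equivariance of the flow direction**: `D(g₁)(x) X(x) = X(g₁ x)` for `x ∈ Λ` (differentiate `g₁ (g_s x) = g_s (g₁ x)` at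
`s = 0⁺`). [folklore] -/
theorem fderiv_apply_flowDir (h : IsHyperbolicSemiflowModel U Λ g m) {x : E} (hx : x ∈ Λ) :
    fderiv ℝ (g 1) x (flowDir g x) = flowDir g (g 1 x) := by
  have hg1 : HasFDerivAt (g 1) (fderiv ℝ (g 1) x) x :=
    (h.hasFDerivAt_map (h.subset hx) ⟨one_pos, one_lt_two⟩).differentiableAt.hasFDerivAt
  have hg1' : HasFDerivAt (g 1) (fderiv ℝ (g 1) x) (g 0 x) := by rwa [h.map_zero x (h.subset hx)]
  have hcomp : HasDerivWithinAt (fun s => g 1 (g s x)) (fderiv ℝ (g 1) x (flowDir g x)) (Ici 0) 0 :=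
    hg1'.comp_hasDerivWithinAt 0 (h.hasDerivWithinAt_flowDir hx)
  have heq : ∀ s ∈ Ici (0 : ℝ), g 1 (g s x) = g s (g 1 x) := fun s hs => by
    rw [← h.map_add_of_mem zero_le_one (mem_Ici.1 hs) hx, add_comm, h.map_add_of_mem (mem_Ici.1 hs) zero_le_one hx]
  have hcomp' : HasDerivWithinAt (fun s => g s (g 1 x)) (fderiv ℝ (g 1) x (flowDir g x)) (Ici 0) 0 :=
    hcomp.congr (fun s hs => (heq s hs).symm) (heq 0 self_mem_Ici).symm
  exact (uniqueDiffOn_Ici (0 : ℝ) 0 self_mem_Ici).eq_deriv _ hcomp' (h.hasDerivWithinAt_flowDir (h.mapsTo 1 zero_le_one hx))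

/-- **The flow direction is carried by the derivative cocycle**: `Tⁿₓ X(x) = X(gₙ x)` for `x ∈ Λ`. [folklore] -/
theorem derivCocycle_apply_flowDir (h : IsHyperbolicSemiflowModel U Λ g m) {x : E} (hx : x ∈ Λ) (n : ℕ) :
    derivCocycle g x n (flowDir g x) = flowDir g (g n x) := by
  induction n with
  | zero => simp [h.map_zero x (h.subset hx)]
  | succ n ih =>
    rw [derivCocycle_succ, ContinuousLinearMap.comp_apply, ih, h.fderiv_apply_flowDir (h.mapsTo n n.cast_nonneg hx),
      ← h.map_natCast_succ n hx]

/-- Hence the images of the flow direction under the cocycle are bounded, in particular of SUB-EXPONENTIAL GROWTH, so the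
hyperbolicity axiom `IsHyperbolicSemiflowModel.hyperbolic` applies to `w = flowDir g x`. [folklore] -/
theorem seqSubExpGrowth_flowDir (h : IsHyperbolicSemiflowModel U Λ g m) {x : E} (hx : x ∈ Λ) :
    SeqSubExpGrowth (fun n => ‖derivCocycle g x n (flowDir g x)‖) := by
  obtain ⟨M, hM⟩ := h.exists_norm_flowDir_le
  intro κ hκ
  refine ⟨max M 0, fun n => ?_⟩
  show ‖derivCocycle g x n (flowDir g x)‖ ≤ _
  rw [h.derivCocycle_apply_flowDir hx]
  calc ‖flowDir g (g n x)‖ ≤ M := hM _ (h.mapsTo n n.cast_nonneg hx)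
    _ ≤ max M 0 := le_max_left _ _
    _ ≤ max M 0 * Real.exp (κ * n) :=
        le_mul_of_one_le_right (le_max_right _ _) (Real.one_le_exp (by positivity))

end IsHyperbolicSemiflowModel

end Literature.Dynamics.Hyperbolic

end
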